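import Literature.AlgebraicGeometry.ShimuraVarieties.UnitaryBallSpecialDiscChart
import Literature.AlgebraicGeometry.ShimuraVarieties.UnitaryBallSpecialCycleAnalytic
import Literature.Geometry.Manifold.QuotientMaps
import HarnessLib

/-!
# The stabiliser `Γ_W` of a line acts on the sub-disc `𝔹_W`; the special curve `Γ_W∖𝔹_W → S(Γ)`

Topic `AlgebraicGeometry/ShimuraVarieties`; namespace
`Literature.AlgebraicGeometry.ShimuraVarieties.UnitaryBallUniformisationDatum`.  Sequel of
`UnitaryBallSpecialDiscChart`.  PROVED here, for `D : UnitaryBallUniformisationDatum 2 X`, a frame `𝔣` and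
`s : D.DiscVec 𝔣` spanning the line `W = E·s`:

* §1 the stabiliser `D.lineStab W ≤ Γ` of an `E`-subspace `W ⊆ V` and `γ·𝔹(W^⊥) = 𝔹(W^⊥)` for `γ ∈ Γ_W`
  (`smul_mem_specialBall_iff_of_mem_lineStab`, from `UnitaryBallSpecialCycleFinite.smul_mem_specialBall_iff`);
* §4 the action of `Γ_W` on the sub-disc `𝔹_W = D.specialDisc 𝔣 s` (restriction of the action of `Γ` on `𝔹²`):
  continuous, FREE (`instIsCancelSMulSpecialDisc`, from `UnitaryBallDiscontinuity.eq_one_of_smul_eq`), PROPERLY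
  DISCONTINUOUS (`instProperlyDiscontinuousSMulSpecialDisc`, from `finite_setOf_smul_mem`) and HOLOMORPHIC
  (`contMDiff_smul_specialDisc`: in the affine chart `γ` acts by a fractional-linear map, `BallModel.contDiffOn_actVec`);
* §5 hence the SPECIAL CURVE `D.specialCurve 𝔣 s = Γ_W∖𝔹_W` is a complex `1`-manifold
  (`Literature.Geometry.Manifold.QuotientManifold.isManifold`), Hausdorff and path connected (the disc is convex in
  its chart); the map `specialCurveMap : Γ_W∖𝔹_W → S(Γ) = Δ∖𝔹²` induced by `𝔹_W ⊆ 𝔹²` is HOLOMORPHIC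
  (`QuotientManifold.contMDiff_comp_mk_iff`), has image the special cycle `D.specialCycle 𝔣 (E·s)`
  (`range_specialCurveMap`), and is INJECTIVE as soon as every `γ ∈ Γ` moving a point of `𝔹_W` into `𝔹_W`
  stabilises `W` (`specialCurveMap_injective` — the injectivity of the level, [Deligne 1971, Prop. 1.15]).

References: S. Kudla, J. Millson, Publ. Math. IHÉS 71 (1990), Lemma 1.1 p. 128 («`j₁` is a proper
embedding onto a totally geodesic submanifold»); N. Bergeron, J. Millson, C. Moeglin, Acta Math. 216
(2016), Introduction §§1.1, 1.7, Part 2 §§1.3, 3.1–3.3; W. Rudin, *Function Theory in the Unit Ball of ℂⁿ*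
(1980), §2.2; P. Deligne, *Travaux de Shimura*, Sém. Bourbaki 389 (1971), Prop. 1.15; J. M. Lee,
*Introduction to Smooth Manifolds*, 2nd ed., Thm. 21.13.
Written for the cell `hodgecm-mathlib` (road (ii) «embedded-curve descent», census `CENSUS-GS3-of-Mumford`
§4 R2-2 / `CENSUS-R2-2-Q2`): the manifold-level input of the algebraisation of special CURVES as smooth
projective closed subschemes (Serre GAGA §2 n°6 via the tree's `ProjectiveManifold.isSmoothProjective_of_isAnalytification`).
HC_CM is proved only modulo the 7 printed citations until rung 0 closes; nothing here is in a registered cone.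
-/

set_option autoImplicit false

noncomputable section

open scoped Manifold ContDiff Topology
open Matrix Complex ComplexConjugate Set Function MulAction
open Literature.Geometry.ComplexHyperbolic
open Literature.Geometry.ComplexHyperbolic.BallModel

namespace Literature.AlgebraicGeometry.ShimuraVarieties

namespace UnitaryBallUniformisationDatum

open Literature.AlgebraicGeometry.Motives (SchemeOver ComplexPoints)

variable {X₂ : SchemeOver ℂ} (D : UnitaryBallUniformisationDatum 2 X₂) (𝔣 : D.SylvesterFrame)

/-! ### §1 The stabiliser of a subspace in `Γ` -/

/-- The **stabiliser** in `Γ` of an `E`-subspace `W ⊆ V` (for the linear action `vact`): the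
`γ ∈ Γ` with `γ W = W` — for a totally positive line `W` this is the arithmetic group `Γ_W` of the special
curve `Γ_W∖𝔹(W^⊥)`. [cite: KudlaMillson1990, Lemma 1.1, p. 128] -/
def lineStab (W : Submodule D.E (Fin 3 → D.E)) : Subgroup D.Γ where
  carrier := {γ | ∀ w, w ∈ W ↔ D.vact γ w ∈ W}
  one_mem' := fun w ↦ by rw [vact_one]
  mul_mem' {γ γ'} hγ hγ' := fun w ↦ by
    rw [vact_mul]
    exact (hγ' w).trans (hγ _)
  inv_mem' {γ} hγ := fun w ↦ by
    have h := hγ (D.vact γ⁻¹ w)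
    rw [vact_vact_inv] at h
    exact h.symm

/-- Membership in the stabiliser. [cite: KudlaMillson1990, Lemma 1.1, p. 128] -/
theorem mem_lineStab_iff {W : Submodule D.E (Fin 3 → D.E)} {γ : D.Γ} :
    γ ∈ D.lineStab W ↔ ∀ w, w ∈ W ↔ D.vact γ w ∈ W :=
  Iff.rfl

/-- An element of the stabiliser maps `W` onto `W`. [cite: KudlaMillson1990, Lemma 1.1, p. 128] -/
theorem vact_image_eq_of_mem_lineStab {W : Submodule D.E (Fin 3 → D.E)} {γ : D.Γ}
    (hγ : γ ∈ D.lineStab W) : D.vact γ '' (W : Set (Fin 3 → D.E)) = W := by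
  refine Set.Subset.antisymm ?_ fun w hw ↦ ?_
  · rintro _ ⟨w, hw, rfl⟩
    exact (hγ w).1 hw
  · refine ⟨D.vact γ⁻¹ w, ?_, D.vact_vact_inv γ w⟩
    exact ((D.lineStab W).inv_mem hγ w).1 hw

/-- A sufficient condition: `γ` maps `W` into `W` and so does `γ⁻¹`. [cite: BergeronMillsonMoeglin2016Balls, Part 2 §3.3] -/
theorem mem_lineStab_of_forall_mem {W : Submodule D.E (Fin 3 → D.E)} {γ : D.Γ}
    (h : ∀ w ∈ W, D.vact γ w ∈ W) (h' : ∀ w ∈ W, D.vact γ⁻¹ w ∈ W) : γ ∈ D.lineStab W :=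
  fun w ↦ ⟨h w, fun hw ↦ by simpa using h' _ hw⟩

/-- **The stabiliser preserves the special sub-ball**: for `γ ∈ Γ_W`, `γ z ∈ 𝔹(W^⊥) ↔ z ∈ 𝔹(W^⊥)`.
[cite: BergeronMillsonMoeglin2016Balls, Part 2 §3.3] -/
theorem smul_mem_specialBall_iff_of_mem_lineStab {W : Submodule D.E (Fin 3 → D.E)} {γ : D.Γ}
    (hγ : γ ∈ D.lineStab W) (z : Ball) :
    D.ballRep 𝔣 γ • z ∈ D.specialBall 𝔣 (W : Set (Fin 3 → D.E)) ↔
      z ∈ D.specialBall 𝔣 (W : Set (Fin 3 → D.E)) := by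
  rw [← D.smul_mem_specialBall_iff 𝔣 γ (W : Set (Fin 3 → D.E)) z, D.vact_image_eq_of_mem_lineStab hγ]

/-- The special sub-ball of a vector is that of the line it spans. [cite: BergeronMillsonMoeglin2016Balls, Part 2 §3.3] -/
theorem specialBall_singleton_eq_span (s : Fin 3 → D.E) :
    D.specialBall 𝔣 {s} = D.specialBall 𝔣 ((D.E ∙ s : Submodule D.E (Fin 3 → D.E)) : Set (Fin 3 → D.E)) := by
  rw [D.specialBall_span 𝔣 {s}]

/-! ### §4 The action of the stabiliser on the sub-disc -/

section Action

variable (s : D.DiscVec 𝔣)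

variable {s} in
/-- The stabiliser of the line `E·s` preserves the sub-disc `𝔹(s^⊥)`. [cite: BergeronMillsonMoeglin2016Balls, Part 2 §3.3] -/
theorem smul_mem_specialBall_singleton {γ : D.Γ} (hγ : γ ∈ D.lineStab (D.E ∙ s.1)) {z : Ball}
    (hz : z ∈ D.specialBall 𝔣 {s.1}) : D.ballRep 𝔣 γ • z ∈ D.specialBall 𝔣 {s.1} := by
  rw [D.specialBall_singleton_eq_span 𝔣 s.1] at hz ⊢
  exact (D.smul_mem_specialBall_iff_of_mem_lineStab 𝔣 hγ z).2 hz

/-- The action of `Γ_W` on `𝔹_W`, restricted from the action of `Γ` on `𝔹²`. [cite: KudlaMillson1990, Lemma 1.1, p. 128] -/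
instance instSMulLineStabSpecialDisc : SMul (D.lineStab (D.E ∙ s.1)) (D.specialDisc 𝔣 s) :=
  ⟨fun γ z ↦ ⟨D.ballRep 𝔣 γ.1 • z.1, D.smul_mem_specialBall_singleton 𝔣 γ.2 z.2⟩⟩

/-- The action on the underlying ball point. [cite: BergeronMillsonMoeglin2016Balls, Part 2 §3.3] -/
@[simp] theorem specialDisc.val_smul (γ : D.lineStab (D.E ∙ s.1)) (z : D.specialDisc 𝔣 s) :
    (γ • z).1 = D.ballRep 𝔣 γ.1 • z.1 := rfl

/-- `Γ_W` acts on `𝔹_W`. [cite: KudlaMillson1990, Lemma 1.1, p. 128] -/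
instance instMulActionLineStabSpecialDisc : MulAction (D.lineStab (D.E ∙ s.1)) (D.specialDisc 𝔣 s) where
  one_smul z := specialDisc.ext D 𝔣 (by
    rw [specialDisc.val_smul, OneMemClass.coe_one, map_one, one_smul])
  mul_smul γ γ' z := specialDisc.ext D 𝔣 (by
    rw [specialDisc.val_smul, specialDisc.val_smul, specialDisc.val_smul, Subgroup.coe_mul, map_mul,
      mul_smul])

/-- The action is by homeomorphisms. [folklore] -/
instance instContinuousConstSMulSpecialDisc :
    ContinuousConstSMul (D.lineStab (D.E ∙ s.1)) (D.specialDisc 𝔣 s) :=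
  ⟨fun γ ↦ Continuous.subtype_mk ((continuous_const_smul (D.ballRep 𝔣 γ.1)).comp continuous_subtype_val) _⟩

/-- **The action of `Γ_W` on `𝔹_W` is free** (`Γ` is torsion free and acts freely on `𝔹²`,
`UnitaryBallDiscontinuity.eq_one_of_smul_eq`). [cite: BergeronMillsonMoeglin2016Balls, Introduction §1.1] -/
instance instIsCancelSMulSpecialDisc : IsCancelSMul (D.lineStab (D.E ∙ s.1)) (D.specialDisc 𝔣 s) where
  left_cancel' γ z w h := specialDisc.ext D 𝔣 (MulAction.injective (D.ballRep 𝔣 γ.1)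
    (by simpa only [specialDisc.val_smul] using congrArg Subtype.val h))
  right_cancel' γ γ' z h := by
    have h1 : D.ballRep 𝔣 γ.1 • z.1 = D.ballRep 𝔣 γ'.1 • z.1 := by
      simpa only [specialDisc.val_smul] using congrArg Subtype.val h
    have h2 : D.ballRep 𝔣 (γ'.1⁻¹ * γ.1) • z.1 = z.1 := by
      rw [map_mul, map_inv, mul_smul, h1, inv_smul_smul]
    have h3 := D.eq_one_of_smul_eq 𝔣 h2
    rw [inv_mul_eq_one] at h3
    exact Subtype.ext h3.symm

/-- **The action of `Γ_W` on `𝔹_W` is properly discontinuous** (restriction of the properly discontinuous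
action of `Γ` on `𝔹²`, `UnitaryBallDiscontinuity.finite_setOf_smul_mem`). [cite: Borel1969, Prop. 7.13] -/
instance instProperlyDiscontinuousSMulSpecialDisc :
    ProperlyDiscontinuousSMul (D.lineStab (D.E ∙ s.1)) (D.specialDisc 𝔣 s) where
  finite_disjoint_inter_image {K L} hK hL := by
    have hK' : IsCompact ((fun z : D.specialDisc 𝔣 s ↦ z.1) '' K) := hK.image continuous_subtype_val
    have hL' : IsCompact ((fun z : D.specialDisc 𝔣 s ↦ z.1) '' L) := hL.image continuous_subtype_val
    have hfin := D.finite_setOf_smul_mem 𝔣 hK' hL'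
    refine (hfin.preimage Subtype.val_injective.injOn).subset fun γ hγ ↦ ?_
    obtain ⟨w, ⟨z, hzK, rfl⟩, hwL⟩ := hγ
    exact ⟨z.1, ⟨z, hzK, rfl⟩, ⟨γ • z, hwL, rfl⟩⟩

/-- **`Γ_W` acts on `𝔹_W` by holomorphic maps** (in the affine chart, `t ↦ ℓ(γ · (p + t d))` is a
fractional-linear function of `t`). [cite: Rudin1980, §2.2] -/
theorem contMDiff_smul_specialDisc (γ : D.lineStab (D.E ∙ s.1)) {n : ℕ∞ω} :
    ContMDiff 𝓘(ℂ, Fin 1 → ℂ) 𝓘(ℂ, Fin 1 → ℂ) n (fun z : D.specialDisc 𝔣 s ↦ γ • z) := by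
  set g : U21 := D.ballRep 𝔣 γ.1 with hg
  set O : Set (Fin 1 → ℂ) :=
    (fun t : Fin 1 → ℂ ↦ D.discParam 𝔣 s.1 (t 0)) ⁻¹' {y : Fin 2 → ℂ | (mat g *ᵥ ![y 0, y 1, 1]) 2 ≠ 0} with hO
  set Φ : (Fin 1 → ℂ) → (Fin 1 → ℂ) :=
    fun t _ ↦ D.discCoord 𝔣 s.1 (actVec g (D.discParam 𝔣 s.1 (t 0))) with hΦ
  have hΦ_smooth : ContDiffOn ℂ n Φ O := by
    rw [contDiffOn_pi]
    intro _
    refine (D.contDiff_discCoord 𝔣 s.1).comp_contDiffOn ?_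
    exact (contDiffOn_actVec g).comp ((D.contDiff_discParam 𝔣 s.1).comp (contDiff_apply ℂ ℂ 0)).contDiffOn
      fun t ht ↦ ht
  have hmaps : ∀ z : D.specialDisc 𝔣 s, D.discChart 𝔣 s z ∈ O := by
    intro z
    change (mat g *ᵥ ![D.discParam 𝔣 s.1 (D.discChart 𝔣 s z 0) 0, D.discParam 𝔣 s.1 (D.discChart 𝔣 s z 0) 1, 1]) 2 ≠ 0
    rw [D.discParam_discChart 𝔣 s z]
    exact W3_2_ne_zero g z.1
  have key : ContMDiff 𝓘(ℂ, Fin 1 → ℂ) 𝓘(ℂ, Fin 1 → ℂ) n (D.discChart 𝔣 s ∘ fun z ↦ γ • z) := by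
    have heq : (D.discChart 𝔣 s ∘ fun z ↦ γ • z) = Φ ∘ D.discChart 𝔣 s := by
      funext z i
      change D.discCoord 𝔣 s.1 (D.ballRep 𝔣 γ.1 • z.1).1 =
        D.discCoord 𝔣 s.1 (actVec g (D.discParam 𝔣 s.1 (D.discChart 𝔣 s z 0)))
      rw [D.discParam_discChart 𝔣 s z, actVec_eq g z.1]
    rw [heq]
    exact hΦ_smooth.contMDiffOn.comp_contMDiff (D.contMDiff_discChart 𝔣 s) hmaps
  exact key.of_comp_isOpenEmbedding (D.isOpenEmbedding_discChart 𝔣 s)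

end Action

/-! ### §5 The special curve `Γ_W∖𝔹_W` and its map to `S(Γ)` -/

section Curve

variable (s : D.DiscVec 𝔣)

/-- The sub-disc is path connected: in the affine chart it is the convex set `{t | |p + t d|² < 1}`.
[cite: BergeronMillsonMoeglin2016Balls, Part 2 §3.3] -/
instance instPathConnectedSpaceSpecialDisc : PathConnectedSpace (D.specialDisc 𝔣 s) := by
  -- convexity of the chart domain
  have hconv : Convex ℝ (D.discDom 𝔣 s) := by
    intro t ht t' ht' a b ha hb hab
    change nsq (D.discParam 𝔣 s.1 ((a • t + b • t') 0)) < 1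
    have hlin : D.discParam 𝔣 s.1 ((a • t + b • t') 0) =
        a • D.discParam 𝔣 s.1 (t 0) + b • D.discParam 𝔣 s.1 (t' 0) := by
      funext i
      simp only [discParam, Pi.add_apply, Pi.smul_apply, smul_eq_mul, Complex.real_smul]
      have hab' : ((a : ℂ) + (b : ℂ)) = 1 := by exact_mod_cast hab
      linear_combination (-(D.discPt 𝔣 s.1 i)) * hab'
    rw [hlin]
    have h1 : nsq (D.discParam 𝔣 s.1 (t 0)) < 1 := ht
    have h2 : nsq (D.discParam 𝔣 s.1 (t' 0)) < 1 := ht'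
    set y := D.discParam 𝔣 s.1 (t 0) with hy
    set y' := D.discParam 𝔣 s.1 (t' 0) with hy'
    have hcomp : ∀ i, ‖(a • y + b • y') i‖ ≤ a * ‖y i‖ + b * ‖y' i‖ := fun i ↦ by
      calc ‖(a • y + b • y') i‖ = ‖(a : ℂ) * y i + (b : ℂ) * y' i‖ := by
            simp [Pi.add_apply, Pi.smul_apply, Complex.real_smul]
        _ ≤ ‖(a : ℂ) * y i‖ + ‖(b : ℂ) * y' i‖ := norm_add_le _ _
        _ = a * ‖y i‖ + b * ‖y' i‖ := by
            rw [norm_mul, norm_mul, Complex.norm_real, Complex.norm_real, Real.norm_eq_abs,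
              Real.norm_eq_abs, abs_of_nonneg ha, abs_of_nonneg hb]
    have hsq : ∀ i, ‖(a • y + b • y') i‖ ^ 2 ≤ a * ‖y i‖ ^ 2 + b * ‖y' i‖ ^ 2 := fun i ↦ by
      have h0 : 0 ≤ ‖(a • y + b • y') i‖ := norm_nonneg _
      have hc := hcomp i
      nlinarith [norm_nonneg (y i), norm_nonneg (y' i), mul_nonneg ha hb,
        sq_nonneg (‖y i‖ - ‖y' i‖)]
    simp only [nsq] at h1 h2 ⊢
    set X := ‖y 0‖ ^ 2 + ‖y 1‖ ^ 2 with hX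
    set X' := ‖y' 0‖ ^ 2 + ‖y' 1‖ ^ 2 with hX'
    have hm : 0 < min (1 - X) (1 - X') := lt_min (by linarith) (by linarith)
    have hmin : (a + b) * min (1 - X) (1 - X') ≤ a * (1 - X) + b * (1 - X') := by
      nlinarith [min_le_left (1 - X) (1 - X'), min_le_right (1 - X) (1 - X')]
    rw [hab, one_mul] at hmin
    nlinarith [hsq 0, hsq 1]
  haveI : PathConnectedSpace (D.discDom 𝔣 s) :=
    isPathConnected_iff_pathConnectedSpace.1
      (hconv.isPathConnected (by
        rw [← D.range_discChart 𝔣 s]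
        exact Set.range_nonempty _))
  -- the sub-disc is the continuous image of the chart domain
  rw [pathConnectedSpace_iff_univ]
  have hsurj : Set.range (D.discInv 𝔣 s) = Set.univ := by
    refine Set.eq_univ_of_forall fun z ↦ ⟨⟨D.discChart 𝔣 s z, D.discChart_mem_discDom 𝔣 s z⟩, ?_⟩
    exact D.discInv_discChart 𝔣 s z _
  rw [← hsurj]
  exact isPathConnected_range (D.continuous_discInv 𝔣 s)

/-- **The special curve** `Γ_W∖𝔹_W`: the orbit space of the sub-disc `𝔹(s^⊥)` by the stabiliser `Γ_W`
of the line `W = E·s` — a complex `1`-manifold (`instIsManifoldSpecialCurve`).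
[cite: KudlaMillson1990, Lemma 1.1, p. 128] [cite: BergeronMillsonMoeglin2016Balls, Part 2 §3.1] -/
abbrev specialCurve : Type := orbitRel.Quotient (D.lineStab (D.E ∙ s.1)) (D.specialDisc 𝔣 s)

/-- The projection `𝔹_W → Γ_W∖𝔹_W`. [folklore] -/
abbrev specialCurveMk : D.specialDisc 𝔣 s → D.specialCurve 𝔣 s :=
  Literature.Geometry.Manifold.QuotientManifold.mk (G := D.lineStab (D.E ∙ s.1)) (M := D.specialDisc 𝔣 s)

/-- **`Γ_W∖𝔹_W` is a complex `1`-manifold.** [cite: BergeronMillsonMoeglin2016Balls, Part 2 §3.1] -/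
instance instIsManifoldSpecialCurve : IsManifold 𝓘(ℂ, Fin 1 → ℂ) ω (D.specialCurve 𝔣 s) :=
  Literature.Geometry.Manifold.QuotientManifold.isManifold fun γ ↦ D.contMDiff_smul_specialDisc 𝔣 s γ

/-- The projection `𝔹_W → Γ_W∖𝔹_W` is holomorphic. [cite: BergeronMillsonMoeglin2016Balls, Part 2 §3.3] -/
theorem contMDiff_specialCurveMk :
    ContMDiff 𝓘(ℂ, Fin 1 → ℂ) 𝓘(ℂ, Fin 1 → ℂ) ω (D.specialCurveMk 𝔣 s) :=
  Literature.Geometry.Manifold.QuotientManifold.contMDiff_mk fun γ ↦ D.contMDiff_smul_specialDisc 𝔣 s γ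

/-- The projection `𝔹_W → Γ_W∖𝔹_W` is a local biholomorphism. [cite: BergeronMillsonMoeglin2016Balls, Part 2 §3.3] -/
theorem isLocalDiffeomorph_specialCurveMk :
    IsLocalDiffeomorph 𝓘(ℂ, Fin 1 → ℂ) 𝓘(ℂ, Fin 1 → ℂ) ω (D.specialCurveMk 𝔣 s) :=
  Literature.Geometry.Manifold.QuotientManifold.isLocalDiffeomorph_mk
    fun γ ↦ D.contMDiff_smul_specialDisc 𝔣 s γ

/-- `Γ_W∖𝔹_W` is Hausdorff. [folklore] -/
instance instT2SpaceSpecialCurve : T2Space (D.specialCurve 𝔣 s) :=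
  t2Space_of_properlyDiscontinuousSMul_of_t2Space

/-- `Γ_W∖𝔹_W` is path connected (image of the disc). [folklore] -/
instance instPathConnectedSpaceSpecialCurve : PathConnectedSpace (D.specialCurve 𝔣 s) := by
  rw [pathConnectedSpace_iff_univ, ← (Quotient.mk_surjective (s := orbitRel _ _)).range_eq]
  exact isPathConnected_range continuous_quotient_mk'

/-- **The map `Γ_W∖𝔹_W → S(Γ) = Δ∖𝔹²` induced by the inclusion `𝔹_W ⊆ 𝔹²`** (well defined: `Γ_W ≤ Γ`).
[cite: KudlaMillson1990, Lemma 1.1, p. 128] -/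
def specialCurveMap : D.specialCurve 𝔣 s → D.quotientSurface 𝔣 :=
  Quotient.lift (fun z : D.specialDisc 𝔣 s ↦ D.quotientSurfaceMk 𝔣 z.1)
    fun z w (h : z ∈ orbit (D.lineStab (D.E ∙ s.1)) w) ↦ by
      obtain ⟨γ, rfl⟩ := h
      exact (D.quotientSurfaceMk_eq_iff 𝔣 _ _).2 ⟨γ.1, rfl⟩

/-- The map on a class: `[z] ↦ Δ·z`. [cite: BergeronMillsonMoeglin2016Balls, Part 2 §3.3] -/
@[simp] theorem specialCurveMap_mk (z : D.specialDisc 𝔣 s) :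
    D.specialCurveMap 𝔣 s (D.specialCurveMk 𝔣 s z) = D.quotientSurfaceMk 𝔣 z.1 := rfl

/-- **`Γ_W∖𝔹_W → S(Γ)` is holomorphic.** [cite: KudlaMillson1990, Lemma 1.1, p. 128] -/
theorem contMDiff_specialCurveMap :
    ContMDiff 𝓘(ℂ, Fin 1 → ℂ) 𝓘(ℂ, Fin 2 → ℂ) ω (D.specialCurveMap 𝔣 s) := by
  rw [← Literature.Geometry.Manifold.QuotientManifold.contMDiff_comp_mk_iff
    (G := D.lineStab (D.E ∙ s.1)) fun γ ↦ D.contMDiff_smul_specialDisc 𝔣 s γ]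
  exact (D.contMDiff_quotientSurfaceMk 𝔣).comp (D.contMDiff_specialDisc_val 𝔣 s)

/-- **The image of `Γ_W∖𝔹_W → S(Γ)` is the special cycle `C_W`** of the line `W = E·s`.
[cite: KudlaMillson1990, Lemma 1.1, p. 128] [cite: BergeronMillsonMoeglin2016Balls, Introduction §1.7] -/
theorem range_specialCurveMap :
    Set.range (D.specialCurveMap 𝔣 s) = D.specialCycle 𝔣 (D.E ∙ s.1) := by
  refine Set.Subset.antisymm ?_ fun x hx ↦ ?_
  · rintro _ ⟨q, rfl⟩
    obtain ⟨z, rfl⟩ := Quotient.mk_surjective (s := orbitRel _ _) q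
    change D.quotientSurfaceMk 𝔣 z.1 ∈ D.specialCycle 𝔣 (D.E ∙ s.1)
    rw [quotientSurfaceMk_mem_specialCycle_iff]
    refine D.specialBall_subset_specialLocus 𝔣 (D.E ∙ s.1) ?_
    rw [← D.specialBall_singleton_eq_span 𝔣 s.1]
    exact z.2
  · obtain ⟨w, hw, rfl⟩ := hx
    obtain ⟨γ, hγ⟩ := (D.mem_specialLocus_iff 𝔣).1 hw
    have hw' : (D.ballRep 𝔣 γ)⁻¹ • w ∈ D.specialBall 𝔣 {s.1} := by
      rw [D.specialBall_singleton_eq_span 𝔣 s.1, ← D.smul_mem_specialBall_iff 𝔣 γ, smul_inv_smul]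
      exact hγ
    refine ⟨D.specialCurveMk 𝔣 s ⟨(D.ballRep 𝔣 γ)⁻¹ • w, hw'⟩, ?_⟩
    rw [specialCurveMap_mk]
    exact (D.quotientSurfaceMk_eq_iff 𝔣 _ _).2 ⟨γ⁻¹, by rw [map_inv]⟩

/-- **Injectivity at injective level**: if every `γ ∈ Γ` moving a point of `𝔹_W` into `𝔹_W` stabilises
`W` (no CM self-intersection of the immersed special curve — [Deligne 1971, Prop. 1.15] at small level),
then `Γ_W∖𝔹_W → S(Γ)` is injective. [cite: Deligne1971TravauxShimura, Prop. 1.15] -/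
theorem specialCurveMap_injective
    (hinj : ∀ γ : D.Γ, (∃ z ∈ D.specialBall 𝔣 {s.1}, D.ballRep 𝔣 γ • z ∈ D.specialBall 𝔣 {s.1}) →
      γ ∈ D.lineStab (D.E ∙ s.1)) :
    Injective (D.specialCurveMap 𝔣 s) := by
  intro q₁ q₂ h
  obtain ⟨z, rfl⟩ := Quotient.mk_surjective (s := orbitRel _ _) q₁
  obtain ⟨w, rfl⟩ := Quotient.mk_surjective (s := orbitRel _ _) q₂
  change D.quotientSurfaceMk 𝔣 z.1 = D.quotientSurfaceMk 𝔣 w.1 at h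
  obtain ⟨γ, hγ⟩ := (D.quotientSurfaceMk_eq_iff 𝔣 _ _).1 h
  have hγW : γ ∈ D.lineStab (D.E ∙ s.1) := hinj γ ⟨w.1, w.2, by rw [hγ]; exact z.2⟩
  exact Literature.Geometry.Manifold.QuotientManifold.mk_eq_mk_iff.2
    ⟨⟨γ, hγW⟩, specialDisc.ext D 𝔣 hγ⟩

end Curve


end UnitaryBallUniformisationDatum

end Literature.AlgebraicGeometry.ShimuraVarieties

end
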